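import Mathlib
import Literature.Computability.AlgebraicComplexity.SimultaneousDoubleProduct
import Summits.MatrixMultiplication.MatrixMultiplication.Theses.FourierTwoFamiliesModP

/-!
# `CommonFrequencyBias` — the forced common-frequency bias beyond the wall

Route `MatrixMultiplication/FourierTwoFamiliesModP`, item `stmt-MatrixMultiplication-14317` (support).
Let `H` be a finite abelian group, `N = |H|`, and `(A i, B i)_{i < n}` pairs of `s`-subsets of `H`
(`s ≥ 1`) with the simultaneous double product property ((W) each `A i ⊕ B i` direct, (X)
simultaneity).  If `N < n s²` then some nontrivial character `ψ` of `H` has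
`n s (n s² − N) ≤ (N − n s) · |T(ψ)|`, where `T(ψ) = Σ_i Â_i(ψ) conj(B̂_i(ψ))`,
`Â_i(ψ) = Σ_{a ∈ A i} ψ a`, `B̂_i(ψ) = Σ_{b ∈ B i} ψ b`.

Proof (linear Fourier analysis on `H`).  Put `X = ⋃ A i`, `Y = ⋃ B i` (`|X| = |Y| = n s`: the
blocks are pairwise disjoint by (X)), `X̂(ψ) = Σ_{x∈X} ψ x`, `Ŷ(ψ) = Σ_{y∈Y} ψ y`.  Orthogonality
of characters gives `Σ_ψ conj(T(ψ)) conj(Ŷ(ψ)) X̂(ψ) = N · Q`, where `Q` counts the solutions of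
`y + (a − b) = x` with `a ∈ A i`, `b ∈ B i` (same `i`), `y ∈ Y`, `x ∈ X`.  For a fixed private
difference `d = a − b`, clause (X) forces every solution `y ∈ B k`, `y + d ∈ A k'` to have
`k = k'`, and clause (W) allows at most one solution inside each pair `(A k, B k)`; so
`Q ≤ n s² · n`.  The `ψ = 1` term is `n s² · n s · n s`; every other term is at most
`M ‖Ŷ(ψ)‖ ‖X̂(ψ)‖ ≤ M (‖Ŷ(ψ)‖² + ‖X̂(ψ)‖²)/2` with `M = max_{ψ ≠ 1} |T(ψ)|`, and Parseval
without the trivial character gives `Σ_{ψ≠1} ‖X̂(ψ)‖² = N n s − (n s)²` (likewise for `Y`).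
Hence `n³ s⁴ ≤ N n² s² + M n s (N − n s)`, i.e. `n s (n s² − N) ≤ (N − n s) M`, and `ψ` is
the maximiser (a nontrivial character exists: `N ≥ 2` because `s² ≤ N`, `n s ≤ N`, `N < n s²`).
Only Mathlib (`AddChar.sum_apply_eq_ite`, `AddChar.card_eq`, `AddChar.map_neg_eq_conj`) and the
Literature SDPP API (`pairwiseDisjoint_of_simultaneous`, `card_mul_card_le_of_dpp`) are used.
-/

-- single-conjunct summit: the mandated namespace repeats `MatrixMultiplication`.
set_option linter.dupNamespace false

namespace Summit.MatrixMultiplication.MatrixMultiplication.Theorems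

namespace FourierTwoFamiliesModPCommonFrequencyBias

open scoped BigOperators Pointwise ComplexConjugate

section General

variable {G : Type*} [AddCommGroup G] [Fintype G] {n : ℕ}

/-- The conjugate of the pair-family sum `T(ψ) = Σ_i Â_i(ψ) conj(B̂_i(ψ))` is the character sum of
the differences `-a + b`, `a ∈ A i`, `b ∈ B i` (the values of `ψ` are unimodular). -/
theorem conj_pairSum (ψ : AddChar G ℂ) (A B : Fin n → Finset G) :
    conj (∑ i, (∑ a ∈ A i, ψ a) * conj (∑ b ∈ B i, ψ b)) =
      ∑ i, ∑ a ∈ A i, ∑ b ∈ B i, ψ (-a + b) := by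
  rw [map_sum]
  refine Finset.sum_congr rfl fun i _ => ?_
  rw [map_mul, Complex.conj_conj, map_sum, Finset.sum_mul_sum]
  refine Finset.sum_congr rfl fun a _ => Finset.sum_congr rfl fun b _ => ?_
  rw [← AddChar.map_neg_eq_conj, AddChar.map_add_eq_mul]

variable [DecidableEq G]

/-- **Parseval without the trivial character**: for a finite set `S` of a finite abelian group
`G`, `Σ_{ψ ≠ 1} ‖Σ_{x∈S} ψ x‖² = |G| · |S| − |S|²` (expand `Ŝ(ψ) conj(Ŝ(ψ))`, swap the sums,
orthogonality `AddChar.sum_apply_eq_ite`, then remove the `ψ = 1` term `|S|²`). -/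
theorem sum_erase_norm_charSum_sq (S : Finset G) :
    ∑ ψ ∈ Finset.univ.erase (1 : AddChar G ℂ), ‖∑ x ∈ S, ψ x‖ ^ 2 =
      (Fintype.card G : ℝ) * S.card - (S.card : ℝ) ^ 2 := by
  have h : ∑ ψ : AddChar G ℂ, (∑ x ∈ S, ψ x) * conj (∑ y ∈ S, ψ y) =
      (Fintype.card G : ℂ) * S.card := by
    calc ∑ ψ : AddChar G ℂ, (∑ x ∈ S, ψ x) * conj (∑ y ∈ S, ψ y)
        = ∑ ψ : AddChar G ℂ, ∑ x ∈ S, ∑ y ∈ S, ψ (x + -y) := by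
          refine Finset.sum_congr rfl fun ψ _ => ?_
          rw [map_sum, Finset.sum_mul_sum]
          refine Finset.sum_congr rfl fun x _ => Finset.sum_congr rfl fun y _ => ?_
          rw [← AddChar.map_neg_eq_conj, AddChar.map_add_eq_mul]
      _ = ∑ x ∈ S, ∑ y ∈ S, ∑ ψ : AddChar G ℂ, ψ (x + -y) := by
          rw [Finset.sum_comm]
          exact Finset.sum_congr rfl fun x _ => Finset.sum_comm
      _ = ∑ x ∈ S, ∑ y ∈ S, if x = y then (Fintype.card G : ℂ) else 0 := by
          refine Finset.sum_congr rfl fun x _ => Finset.sum_congr rfl fun y _ => ?_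
          rw [AddChar.sum_apply_eq_ite]
          exact if_congr (by rw [← sub_eq_add_neg, sub_eq_zero]) rfl rfl
      _ = ∑ _x ∈ S, (Fintype.card G : ℂ) := by
          refine Finset.sum_congr rfl fun x hx => ?_
          rw [Finset.sum_ite_eq, if_pos hx]
      _ = (Fintype.card G : ℂ) * S.card := by
          rw [Finset.sum_const, nsmul_eq_mul, mul_comm]
  have hψ : ∀ ψ : AddChar G ℂ,
      (∑ x ∈ S, ψ x) * conj (∑ y ∈ S, ψ y) = ((‖∑ x ∈ S, ψ x‖ ^ 2 : ℝ) : ℂ) := by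
    intro ψ
    rw [Complex.mul_conj', Complex.ofReal_pow]
  simp_rw [hψ] at h
  have hall : ∑ ψ : AddChar G ℂ, ‖∑ x ∈ S, ψ x‖ ^ 2 = (Fintype.card G : ℝ) * S.card := by
    exact_mod_cast h
  rw [Finset.sum_erase_eq_sub (Finset.mem_univ _), hall]
  simp only [AddChar.one_apply, Finset.sum_const, nsmul_eq_mul, mul_one, Complex.norm_natCast]

/-- **Counting by orthogonality** for a family of pairs and two sets:
`Σ_ψ (Σ_i Σ_{a∈A i} Σ_{b∈B i} ψ(-a+b)) · (Σ_{y∈Y} ψ(-y)) · (Σ_{x∈X} ψ x) = |G| · Q`, where `Q` is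
the number of solutions of `y + (a - b) = x`, `a ∈ A i`, `b ∈ B i`, `y ∈ Y`, `x ∈ X`. -/
theorem sum_pairSum_mul_charSum (X Y : Finset G) (A B : Fin n → Finset G) :
    ∑ ψ : AddChar G ℂ, (∑ i, ∑ a ∈ A i, ∑ b ∈ B i, ψ (-a + b)) *
        ((∑ y ∈ Y, ψ (-y)) * (∑ x ∈ X, ψ x)) =
      (Fintype.card G : ℂ) *
        ((∑ i, ∑ a ∈ A i, ∑ b ∈ B i, ∑ y ∈ Y, ∑ x ∈ X,
            if y + (a - b) = x then 1 else 0 : ℕ) : ℂ) := by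
  have key : ∀ a b y x : G, (-a + b + (-y + x) = 0) ↔ (y + (a - b) = x) := by
    intro a b y x
    rw [show -a + b + (-y + x) = x - (y + (a - b)) by abel, sub_eq_zero, eq_comm]
  calc ∑ ψ : AddChar G ℂ, (∑ i, ∑ a ∈ A i, ∑ b ∈ B i, ψ (-a + b)) *
        ((∑ y ∈ Y, ψ (-y)) * (∑ x ∈ X, ψ x))
      = ∑ ψ : AddChar G ℂ, ∑ i, ∑ a ∈ A i, ∑ b ∈ B i, ∑ y ∈ Y, ∑ x ∈ X,
          ψ (-a + b + (-y + x)) := by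
        refine Finset.sum_congr rfl fun ψ _ => ?_
        rw [Finset.sum_mul]
        refine Finset.sum_congr rfl fun i _ => ?_
        rw [Finset.sum_mul]
        refine Finset.sum_congr rfl fun a _ => ?_
        rw [Finset.sum_mul]
        refine Finset.sum_congr rfl fun b _ => ?_
        rw [Finset.sum_mul_sum, Finset.mul_sum]
        refine Finset.sum_congr rfl fun y _ => ?_
        rw [Finset.mul_sum]
        refine Finset.sum_congr rfl fun x _ => ?_
        rw [← AddChar.map_add_eq_mul, ← AddChar.map_add_eq_mul]
    _ = ∑ i, ∑ a ∈ A i, ∑ b ∈ B i, ∑ y ∈ Y, ∑ x ∈ X, ∑ ψ : AddChar G ℂ,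
          ψ (-a + b + (-y + x)) := by
        rw [Finset.sum_comm]
        refine Finset.sum_congr rfl fun i _ => ?_
        rw [Finset.sum_comm]
        refine Finset.sum_congr rfl fun a _ => ?_
        rw [Finset.sum_comm]
        refine Finset.sum_congr rfl fun b _ => ?_
        rw [Finset.sum_comm]
        refine Finset.sum_congr rfl fun y _ => ?_
        exact Finset.sum_comm
    _ = ∑ i, ∑ a ∈ A i, ∑ b ∈ B i, ∑ y ∈ Y, ∑ x ∈ X,
          if y + (a - b) = x then (Fintype.card G : ℂ) else 0 := by
        refine Finset.sum_congr rfl fun i _ => Finset.sum_congr rfl fun a _ =>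
          Finset.sum_congr rfl fun b _ => Finset.sum_congr rfl fun y _ =>
          Finset.sum_congr rfl fun x _ => ?_
        rw [AddChar.sum_apply_eq_ite]
        exact if_congr (key a b y x) rfl rfl
    _ = (Fintype.card G : ℂ) *
          ((∑ i, ∑ a ∈ A i, ∑ b ∈ B i, ∑ y ∈ Y, ∑ x ∈ X,
              if y + (a - b) = x then 1 else 0 : ℕ) : ℂ) := by
        simp only [Nat.cast_sum, Nat.cast_ite, Nat.cast_one, Nat.cast_zero, Finset.mul_sum,
          mul_ite, mul_one, mul_zero]

/-- **Key inequality.**  If `|T(ψ)| ≤ M` for every nontrivial character `ψ` (`0 ≤ M`) and the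
solution count of `sum_pairSum_mul_charSum` is at most `Q`, then
`(Σ_i |A i| |B i|) · |Y| · |X| ≤ |G| · Q + M · ((|G| |Y| − |Y|²) + (|G| |X| − |X|²)) / 2`:
isolate the `ψ = 1` term, bound the others by `M ‖Ŷ‖ ‖X̂‖ ≤ M (‖Ŷ‖² + ‖X̂‖²)/2` and use
Parseval with the trivial character removed. -/
theorem main_le (X Y : Finset G) (A B : Fin n → Finset G) {M : ℝ} (hM0 : 0 ≤ M)
    (hM : ∀ ψ : AddChar G ℂ, ψ ≠ 1 → ‖∑ i, (∑ a ∈ A i, ψ a) * conj (∑ b ∈ B i, ψ b)‖ ≤ M)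
    {Q : ℕ}
    (hQ : (∑ i, ∑ a ∈ A i, ∑ b ∈ B i, ∑ y ∈ Y, ∑ x ∈ X,
            if y + (a - b) = x then 1 else 0 : ℕ) ≤ Q) :
    ((∑ i, (A i).card * (B i).card : ℕ) : ℝ) * Y.card * X.card ≤
      Fintype.card G * Q +
        M * ((Fintype.card G * Y.card - (Y.card : ℝ) ^ 2 +
              (Fintype.card G * X.card - (X.card : ℝ) ^ 2)) / 2) := by
  classical
  -- `Σ_{y ∈ S} ψ (-y) = conj Ŝ(ψ)` (unimodular values)
  have hneg : ∀ (ψ : AddChar G ℂ) (S : Finset G), ∑ x ∈ S, ψ (-x) = conj (∑ x ∈ S, ψ x) :=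
    fun ψ S => by
      rw [map_sum]
      exact Finset.sum_congr rfl fun x _ => AddChar.map_neg_eq_conj ψ x
  set Φ : AddChar G ℂ → ℂ := fun ψ =>
    (∑ i, ∑ a ∈ A i, ∑ b ∈ B i, ψ (-a + b)) * ((∑ y ∈ Y, ψ (-y)) * (∑ x ∈ X, ψ x)) with hΦ
  have hsum : ∑ ψ, Φ ψ = (Fintype.card G : ℂ) *
      ((∑ i, ∑ a ∈ A i, ∑ b ∈ B i, ∑ y ∈ Y, ∑ x ∈ X,
          if y + (a - b) = x then 1 else 0 : ℕ) : ℂ) :=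
    sum_pairSum_mul_charSum X Y A B
  have hΦ1 : Φ 1 = ((∑ i, (A i).card * (B i).card : ℕ) : ℂ) * Y.card * X.card := by
    simp only [hΦ, AddChar.one_apply, Finset.sum_const, nsmul_eq_mul, mul_one, Nat.cast_sum,
      Nat.cast_mul]
    ring
  have hsplit : Φ 1 = ∑ ψ, Φ ψ - ∑ ψ ∈ Finset.univ.erase (1 : AddChar G ℂ), Φ ψ := by
    rw [← Finset.add_sum_erase Finset.univ Φ (Finset.mem_univ 1), add_sub_cancel_right]
  have hterm : ∀ ψ ∈ Finset.univ.erase (1 : AddChar G ℂ),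
      ‖Φ ψ‖ ≤ M * ((‖∑ y ∈ Y, ψ y‖ ^ 2 + ‖∑ x ∈ X, ψ x‖ ^ 2) / 2) := by
    intro ψ hψ
    have hψ1 : ψ ≠ 1 := Finset.ne_of_mem_erase hψ
    have h2 := two_mul_le_add_sq ‖∑ y ∈ Y, ψ y‖ ‖∑ x ∈ X, ψ x‖
    calc ‖Φ ψ‖ = ‖∑ i, (∑ a ∈ A i, ψ a) * conj (∑ b ∈ B i, ψ b)‖ *
          (‖∑ y ∈ Y, ψ y‖ * ‖∑ x ∈ X, ψ x‖) := by
          simp only [hΦ]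
          rw [← conj_pairSum, hneg, norm_mul, norm_mul, Complex.norm_conj, Complex.norm_conj]
      _ ≤ M * (‖∑ y ∈ Y, ψ y‖ * ‖∑ x ∈ X, ψ x‖) := by
          gcongr
          exact hM ψ hψ1
      _ = M * (2 * ‖∑ y ∈ Y, ψ y‖ * ‖∑ x ∈ X, ψ x‖) / 2 := by ring
      _ ≤ M * (‖∑ y ∈ Y, ψ y‖ ^ 2 + ‖∑ x ∈ X, ψ x‖ ^ 2) / 2 := by gcongr
      _ = M * ((‖∑ y ∈ Y, ψ y‖ ^ 2 + ‖∑ x ∈ X, ψ x‖ ^ 2) / 2) := by ring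
  calc ((∑ i, (A i).card * (B i).card : ℕ) : ℝ) * Y.card * X.card = ‖Φ 1‖ := by
        rw [hΦ1, norm_mul, norm_mul, Complex.norm_natCast, Complex.norm_natCast,
          Complex.norm_natCast]
    _ = ‖∑ ψ, Φ ψ - ∑ ψ ∈ Finset.univ.erase (1 : AddChar G ℂ), Φ ψ‖ := by rw [← hsplit]
    _ ≤ ‖∑ ψ, Φ ψ‖ + ‖∑ ψ ∈ Finset.univ.erase (1 : AddChar G ℂ), Φ ψ‖ := norm_sub_le _ _
    _ ≤ (Fintype.card G : ℝ) * Q + ∑ ψ ∈ Finset.univ.erase (1 : AddChar G ℂ), ‖Φ ψ‖ := by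
        gcongr ?_ + ?_
        · rw [hsum, norm_mul, Complex.norm_natCast, Complex.norm_natCast]
          gcongr
        · exact norm_sum_le _ _
    _ ≤ (Fintype.card G : ℝ) * Q + ∑ ψ ∈ Finset.univ.erase (1 : AddChar G ℂ),
          M * ((‖∑ y ∈ Y, ψ y‖ ^ 2 + ‖∑ x ∈ X, ψ x‖ ^ 2) / 2) := by
        gcongr with ψ hψ
        exact hterm ψ hψ
    _ = (Fintype.card G : ℝ) * Q +
          M * ((Fintype.card G * Y.card - (Y.card : ℝ) ^ 2 +
                (Fintype.card G * X.card - (X.card : ℝ) ^ 2)) / 2) := by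
        rw [← Finset.mul_sum, ← Finset.sum_div, Finset.sum_add_distrib, sum_erase_norm_charSum_sq,
          sum_erase_norm_charSum_sq]

end General

section Families

variable {G : Type*} [AddCommGroup G] [DecidableEq G] {n : ℕ}

/-- **The shift count.**  Under (W) and (X), for a private difference `d = a' - b'` (`a' ∈ A j`,
`b' ∈ B j`) the number of `y ∈ ⋃ B k` with `y + d ∈ ⋃ A i` is at most `n`: by (X) such a `y ∈ B k`
has `y + d ∈ A k`, and by (W) each pair `(A k, B k)` contains at most one such `y`. -/
theorem shiftCount_le (A B : Fin n → Finset G)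
    (hW : ∀ i : Fin n, ∀ a ∈ A i, ∀ a' ∈ A i, ∀ b ∈ B i, ∀ b' ∈ B i,
      (a - a') + (b - b') = 0 → a = a' ∧ b = b')
    (hX : ∀ i j k : Fin n, ∀ a ∈ A i, ∀ a' ∈ A j, ∀ b ∈ B j, ∀ b' ∈ B k,
      (a - a') + (b - b') = 0 → i = k)
    {j : Fin n} {a' b' : G} (ha' : a' ∈ A j) (hb' : b' ∈ B j) :
    (∑ y ∈ Finset.univ.biUnion B, ∑ x ∈ Finset.univ.biUnion A,
        if y + (a' - b') = x then 1 else 0 : ℕ) ≤ n := by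
  calc (∑ y ∈ Finset.univ.biUnion B, ∑ x ∈ Finset.univ.biUnion A,
        if y + (a' - b') = x then 1 else 0 : ℕ)
      = ((Finset.univ.biUnion B).filter
          (fun y => y + (a' - b') ∈ Finset.univ.biUnion A)).card := by
        simp_rw [Finset.sum_ite_eq]
        rw [Finset.card_filter]
    _ ≤ (Finset.univ.biUnion fun k => (B k).filter (fun y => y + (a' - b') ∈ A k)).card := by
        refine Finset.card_le_card ?_
        intro y hy
        rw [Finset.mem_filter] at hy
        obtain ⟨hyY, hyX⟩ := hy
        obtain ⟨k, -, hyk⟩ := Finset.mem_biUnion.mp hyY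
        obtain ⟨i, -, hxi⟩ := Finset.mem_biUnion.mp hyX
        have hik : i = k := hX i j k _ hxi a' ha' b' hb' y hyk (by abel)
        subst hik
        exact Finset.mem_biUnion.mpr ⟨i, Finset.mem_univ _, Finset.mem_filter.mpr ⟨hyk, hxi⟩⟩
    _ ≤ ∑ k, ((B k).filter (fun y => y + (a' - b') ∈ A k)).card := Finset.card_biUnion_le
    _ ≤ ∑ _k : Fin n, 1 := by
        refine Finset.sum_le_sum fun k _ => ?_
        rw [Finset.card_le_one]
        intro y hy y' hy'
        rw [Finset.mem_filter] at hy hy'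
        exact ((hW k _ hy.2 _ hy'.2 y' hy'.1 y hy.1 (by abel)).2).symm
    _ = n := by simp

/-- **The solution count** `Q ≤ n s² · n`: sum `shiftCount_le` over the `n s²` private
differences `a - b`, `a ∈ A i`, `b ∈ B i`. -/
theorem solutionCount_le {s : ℕ} (A B : Fin n → Finset G)
    (hcard : ∀ i : Fin n, (A i).card = s ∧ (B i).card = s)
    (hW : ∀ i : Fin n, ∀ a ∈ A i, ∀ a' ∈ A i, ∀ b ∈ B i, ∀ b' ∈ B i,
      (a - a') + (b - b') = 0 → a = a' ∧ b = b')
    (hX : ∀ i j k : Fin n, ∀ a ∈ A i, ∀ a' ∈ A j, ∀ b ∈ B j, ∀ b' ∈ B k,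
      (a - a') + (b - b') = 0 → i = k) :
    (∑ i, ∑ a ∈ A i, ∑ b ∈ B i, ∑ y ∈ Finset.univ.biUnion B, ∑ x ∈ Finset.univ.biUnion A,
        if y + (a - b) = x then 1 else 0 : ℕ) ≤ n * (s * (s * n)) := by
  calc (∑ i, ∑ a ∈ A i, ∑ b ∈ B i, ∑ y ∈ Finset.univ.biUnion B, ∑ x ∈ Finset.univ.biUnion A,
        if y + (a - b) = x then 1 else 0 : ℕ)
      ≤ ∑ i : Fin n, ∑ a ∈ A i, ∑ _b ∈ B i, n :=
        Finset.sum_le_sum fun i _ => Finset.sum_le_sum fun a ha =>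
          Finset.sum_le_sum fun b hb => shiftCount_le A B hW hX ha hb
    _ = ∑ _i : Fin n, s * (s * n) := by
        refine Finset.sum_congr rfl fun i _ => ?_
        rw [Finset.sum_const, Finset.sum_const, smul_eq_mul, smul_eq_mul, (hcard i).1,
          (hcard i).2]
    _ = n * (s * (s * n)) := by
        rw [Finset.sum_const, Finset.card_univ, Fintype.card_fin, smul_eq_mul]

end Families

end FourierTwoFamiliesModPCommonFrequencyBias

open scoped BigOperators ComplexConjugate in
open FourierTwoFamiliesModPCommonFrequencyBias in
/-- **Forced common-frequency bias** (settles `stmt-MatrixMultiplication-14317`, exact route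
signature `Summit.MatrixMultiplication.MatrixMultiplication.Theses.FourierTwoFamiliesModP.CommonFrequencyBias`):
for pairs `(A i, B i)_{i<n}` of `s`-subsets (`s ≥ 1`) of a finite abelian group `H` with the
simultaneous double product property and `|H| < n s²`, some nontrivial character `ψ` has
`n s (n s² − |H|) ≤ (|H| − n s) · ‖Σ_i (Σ_{a∈A i} ψ a) conj(Σ_{b∈B i} ψ b)‖`.  Take `ψ` maximising
the norm among nontrivial characters and combine `main_le` (orthogonality, the `ψ = 1` term,
`2ab ≤ a² + b²`, Parseval without the trivial character) with `solutionCount_le` ((X) routes every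
solution into one pair, (W) makes it unique there). -/
theorem CommonFrequencyBias_proof :
    Summit.MatrixMultiplication.MatrixMultiplication.Theses.FourierTwoFamiliesModP.CommonFrequencyBias := by
  unfold Summit.MatrixMultiplication.MatrixMultiplication.Theses.FourierTwoFamiliesModP.CommonFrequencyBias
  intro H _ _ n s A B hs hcard hW hX hlt
  classical
  -- all blocks are nonempty, so (X) makes the `A i` pairwise disjoint and the `B i` pairwise
  -- disjoint: `|⋃ A i| = |⋃ B i| = n s`, hence `n s ≤ |H|`; also `s² ≤ |H|` by (W), and `0 < n`
  have hne : ∀ i : Fin n, (A i).Nonempty ∧ (B i).Nonempty := fun i =>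
    ⟨Finset.card_pos.mp (by rw [(hcard i).1]; exact hs),
      Finset.card_pos.mp (by rw [(hcard i).2]; exact hs)⟩
  have hd := Literature.Computability.AlgebraicComplexity.pairwiseDisjoint_of_simultaneous hX hne
  have hA : ((Finset.univ : Finset (Fin n)) : Set (Fin n)).PairwiseDisjoint A :=
    fun i _ j _ hij => (hd i j hij).1
  have hB : ((Finset.univ : Finset (Fin n)) : Set (Fin n)).PairwiseDisjoint B :=
    fun i _ j _ hij => (hd i j hij).2
  have hXc : (Finset.univ.biUnion A).card = n * s := by
    rw [Finset.card_biUnion hA, Finset.sum_congr rfl fun i _ => (hcard i).1, Finset.sum_const,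
      Finset.card_univ, Fintype.card_fin, smul_eq_mul]
  have hYc : (Finset.univ.biUnion B).card = n * s := by
    rw [Finset.card_biUnion hB, Finset.sum_congr rfl fun i _ => (hcard i).2, Finset.sum_const,
      Finset.card_univ, Fintype.card_fin, smul_eq_mul]
  have hn : 0 < n := by
    rcases Nat.eq_zero_or_pos n with rfl | h
    · simp at hlt
    · exact h
  have hnsN : n * s ≤ Fintype.card H := by
    rw [← hXc]
    exact Finset.card_le_univ _
  have hssN : s * s ≤ Fintype.card H := by
    have h := Literature.Computability.AlgebraicComplexity.card_mul_card_le_of_dpp (hW ⟨0, hn⟩)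
    rwa [(hcard ⟨0, hn⟩).1, (hcard ⟨0, hn⟩).2] at h
  -- a nontrivial character exists (`|H| ≥ 2`)
  have h1 : 1 < Fintype.card (AddChar H ℂ) := by
    rw [AddChar.card_eq]
    by_contra hle
    push Not at hle
    have hs1 : s ≤ 1 := by
      by_contra hs2
      push Not at hs2
      have : 2 * 2 ≤ s * s := Nat.mul_le_mul hs2 hs2
      omega
    have hs1' : s = 1 := le_antisymm hs1 hs
    subst hs1'
    simp only [mul_one, one_pow] at hnsN hlt
    omega
  obtain ⟨ψ₁, hψ₁⟩ := Fintype.exists_ne_of_one_lt_card h1 1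
  haveI : Nonempty {ψ : AddChar H ℂ // ψ ≠ 1} := ⟨⟨ψ₁, hψ₁⟩⟩
  obtain ⟨⟨ψ₀, hψ₀⟩, hmax⟩ :=
    Finite.exists_max fun ψ : {ψ : AddChar H ℂ // ψ ≠ 1} =>
      ‖∑ i, (∑ a ∈ A i, ψ.1 a) * conj (∑ b ∈ B i, ψ.1 b)‖
  refine ⟨ψ₀, hψ₀, ?_⟩
  set M : ℝ := ‖∑ i, (∑ a ∈ A i, ψ₀ a) * conj (∑ b ∈ B i, ψ₀ b)‖ with hMdef
  have hM : ∀ ψ : AddChar H ℂ, ψ ≠ 1 →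
      ‖∑ i, (∑ a ∈ A i, ψ a) * conj (∑ b ∈ B i, ψ b)‖ ≤ M := fun ψ hψ => hmax ⟨ψ, hψ⟩
  have hM0 : 0 ≤ M := norm_nonneg _
  -- the key inequality with `X = ⋃ A i`, `Y = ⋃ B i`, `Q ≤ n s² n`
  have hQ := solutionCount_le A B hcard hW hX
  have key := main_le (Finset.univ.biUnion A) (Finset.univ.biUnion B) A B hM0 hM hQ
  have hABc : (∑ i, (A i).card * (B i).card : ℕ) = n * (s * s) := by
    rw [Finset.sum_congr rfl fun i _ => by rw [(hcard i).1, (hcard i).2], Finset.sum_const,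
      Finset.card_univ, Fintype.card_fin, smul_eq_mul]
  rw [hABc, hXc, hYc] at key
  push_cast at key
  -- divide `n³ s⁴ − |H| n² s² ≤ M n s (|H| − n s)` by `n s > 0`
  have hn0 : (0 : ℝ) < n := by exact_mod_cast hn
  have hs0 : (0 : ℝ) < s := by exact_mod_cast hs
  have hns : (0 : ℝ) < n * s := mul_pos hn0 hs0
  refine le_of_mul_le_mul_left ?_ hns
  have e1 : (n : ℝ) * s * ((n : ℝ) * s * ((n : ℝ) * (s : ℝ) ^ 2 - Fintype.card H)) =
      (n : ℝ) * (s * s) * (n * s) * (n * s) - Fintype.card H * (n * (s * (s * n))) := by ring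
  have e2 : (n : ℝ) * s * ((Fintype.card H - (n : ℝ) * s) * M) =
      M * ((Fintype.card H * (n * s) - ((n : ℝ) * s) ^ 2 +
        (Fintype.card H * (n * s) - ((n : ℝ) * s) ^ 2)) / 2) := by ring
  rw [e1, e2]
  linarith [key]

end Summit.MatrixMultiplication.MatrixMultiplication.Theorems
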